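import Literature.AlgebraicGeometry.Motives.PicardQuarticFunctionField
import Literature.AlgebraicGeometry.Motives.CartierDivisor
import HarnessLib

/-!
# `K(X_F) ≃ₐ[K] K(x)[y]/(y³ - g)`: the function field of the Picard quartic as a `K`-algebra

`Motives/PicardQuarticFunctionField` identifies the function field of the smooth plane quartic
`X_F = V₊(y³z - z⁴g(x/z))` with `SuperellipticFunctionField K K 3 g = K(x)[y]/(y³ - g)` as a ring
(`functionFieldEquiv`). Here we check that the identification respects the `K`-algebra structure
`RatFn.algebraStalk` on `K(X_F)` (the one through which `Motives/CurvePlaces` reads the places of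
`K(X_F)/K`): the chart `Spec K[x][y]/(y³ - g) → X_F` is a morphism over `Spec K`, so the structure
section `c ∈ K ⊆ Γ(X_F, 𝒪)` restricts on `{z ≠ 0}` to the constant `c` of `K[x][y]/(y³ - g)`
(`sectionsChartOpenEquiv_symm_algebraMap`: `Over.w`, `Scheme.ΓSpecIso_inv_naturality`,
`Scheme.Hom.app_appIso_inv`), whence `functionFieldEquiv_algebraMap` and the `K`-algebra isomorphism
**`functionFieldAlgEquiv : K(X_F) ≃ₐ[K] SuperellipticFunctionField K K 3 g`**. With it, places,
divisors and divisor classes of `K(X_F)/K` (`Motives/CurvePlaces`, `CurveDivisorsFunctionField`) can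
be transported to the function-field side of the Picard curve (`GaloisRepresentations/Superelliptic*`).

Everything is proved; no named facts (D-0026).

## References

* R. Hartshorne, *Algebraic Geometry*, GTM 52 (1977): II Ex. 3.6, II Ex. 2.4 (schemes over a ring
  and ring maps). [Hartshorne1977]
-/

noncomputable section

open MvPolynomial

universe u

namespace Literature.AlgebraicGeometry.Motives.PicardQuartic

open SmoothHypersurface CategoryTheory _root_.AlgebraicGeometry Literature.NumberTheory.GaloisRepresentations

variable {K : Type u} [Field K] {g : Polynomial K} (hsep : g.Separable) (hg : g.natDegree = 4)

/-- The chart is compatible with the `K`-structures: `Γ(X_F, {z ≠ 0}) ≅ K[x][y]/(y³ - g)` sends the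
restriction of the structure section `c ∈ K ⊆ Γ(X_F, 𝒪)` to `c` (the chart is a morphism over
`Spec K`). [folklore] -/
theorem sectionsChartOpenEquiv_symm_algebraMap (c : K) :
    (sectionsChartOpenEquiv hsep hg).symm (algebraMap K (affineRing g) c) =
      (hypersurface (picardForm g)).left.presheaf.map (homOfLE le_top).op
        ((hypersurface (picardForm g)).hom.appTop ((Scheme.ΓSpecIso (.of K)).inv c)) := by
  set X := hypersurface (picardForm g)
  set f := (affineChart hsep hg).left
  -- `(ΓSpecIso A)⁻¹ (algebraMap c) = (Spec algebraMap)^* ((ΓSpecIso K)⁻¹ c) = f^* (X.hom^* _)`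
  have h1 : (Scheme.ΓSpecIso (CommRingCat.of (affineRing g))).inv (algebraMap K (affineRing g) c) =
      f.appTop (X.hom.appTop ((Scheme.ΓSpecIso (.of K)).inv c)) := by
    have hw : f ≫ X.hom = Spec.map (CommRingCat.ofHom (algebraMap K (affineRing g))) := Over.w _
    have hn := congrArg (fun φ => φ.hom c)
      (Scheme.ΓSpecIso_inv_naturality (CommRingCat.ofHom (algebraMap K (affineRing g))))
    simp only [CommRingCat.hom_comp, RingHom.coe_comp, Function.comp_apply, CommRingCat.hom_ofHom] at hn
    rw [hn, ← hw]
    rfl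
  change ((affineChart hsep hg).left.appIso ⊤).inv ((Scheme.ΓSpecIso (CommRingCat.of (affineRing g))).inv
    (algebraMap K (affineRing g) c)) = _
  rw [h1]
  exact congrArg (fun φ => φ.hom (X.hom.appTop ((Scheme.ΓSpecIso (.of K)).inv c)))
    (Scheme.Hom.app_appIso_inv f ⊤)

variable [Fact (Irreducible (superellipticPoly K K 3 g))] [IsIntegral (hypersurface (picardForm g)).left]

/-- **`functionFieldEquiv` is `K`-linear** (for the `K`-algebra structure `RatFn.algebraStalk` on
`K(X_F)` used by `Motives/CurvePlaces`): it is an isomorphism of `K`-algebras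
`K(X_F) ≃ₐ[K] K(x)[y]/(y³ - g)`. [folklore] -/
theorem functionFieldEquiv_algebraMap (c : K) :
    functionFieldEquiv hsep hg (algebraMap K _ c) = algebraMap K (SuperellipticFunctionField K K 3 g) c := by
  haveI hfr := functionField_isFractionRing_of_isAffineOpen (hypersurface (picardForm g)).left
    (chartOpen hsep hg) (isAffineOpen_chartOpen hsep hg)
  letI alg : Algebra (affineRing g) (hypersurface (picardForm g)).left.functionField :=
    ((algebraMap Γ((hypersurface (picardForm g)).left, chartOpen hsep hg) _).comp
      (sectionsChartOpenEquiv hsep hg).symm.toRingHom).toAlgebra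
  haveI : IsFractionRing (affineRing g) (hypersurface (picardForm g)).left.functionField :=
    (IsFractionRing.isFractionRing_iff_of_base_ringEquiv _ (sectionsChartOpenEquiv hsep hg)).mp hfr
  have key : algebraMap (affineRing g) (hypersurface (picardForm g)).left.functionField
      (algebraMap K (affineRing g) c) = algebraMap K _ c := by
    change algebraMap Γ((hypersurface (picardForm g)).left, chartOpen hsep hg) _
      ((sectionsChartOpenEquiv hsep hg).symm (algebraMap K (affineRing g) c)) = _
    rw [sectionsChartOpenEquiv_symm_algebraMap, RatFn.algebraMap_stalk_apply]
    exact TopCat.Presheaf.germ_res_apply (hypersurface (picardForm g)).left.presheaf (homOfLE le_top)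
      (genericPoint (hypersurface (picardForm g)).left) _ _
  calc functionFieldEquiv hsep hg (algebraMap K _ c)
      = (IsLocalization.algEquiv (nonZeroDivisors (affineRing g))
          ((hypersurface (picardForm g)).left.functionField) (SuperellipticFunctionField K K 3 g))
          (algebraMap (affineRing g) _ (algebraMap K (affineRing g) c)) := by rw [key]; rfl
    _ = algebraMap (affineRing g) (SuperellipticFunctionField K K 3 g) (algebraMap K (affineRing g) c) :=
          AlgEquiv.commutes _ _
    _ = algebraMap K (SuperellipticFunctionField K K 3 g) c := (IsScalarTower.algebraMap_apply _ _ _ c).symm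

/-- **`K(X_F) ≃ₐ[K] K(x)[y]/(y³ - g)`** as `K`-algebras. [folklore] -/
def functionFieldAlgEquiv :
    (hypersurface (picardForm g)).left.functionField ≃ₐ[K] SuperellipticFunctionField K K 3 g :=
  { functionFieldEquiv hsep hg with commutes' := functionFieldEquiv_algebraMap hsep hg }


end Literature.AlgebraicGeometry.Motives.PicardQuartic

end
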